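import Summits.AtomisticToContinuum.FouriersLaw.Theorems.PhononMeanFreePathIncoherentChannelTwoHorizonsCrux
import Summits.AtomisticToContinuum.FouriersLaw.Theorems.PhononMeanFreePathKuboFormFouriersLaw

/-!
# `stub_varianceLimit` is, given the forecast-loss envelope, EQUIVALENT to the conjunct `FouriersLaw`

Route `PhononMeanFreePath`, crux `IncoherentChannel` (stmt-AtomisticToContinuum-11811), line
`two-horizons-forecast-loss`, registered stub `stub_varianceLimit` (the reshaped transport core):

  `∀ ω₂ lam β γ > 0, ∀ T > 0, ∃ κ > 0, N·(γ²/T²)·∫₀^∞ B_N(t) dt → κ`,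
  `B_N = varianceChannel ω₂ lam β γ T N = powerCov − commonPast = Cov_{μ₀}(p_0², Var(p_N(t) | z_0))`.

This file is the kernel-checked CERTIFICATE of what the stub is worth; it does NOT prove the stub. Composing two landed,
unconditional facts,

* `powerCovLimit_iff_varianceLimit_of_forecastLoss` (TwoHorizonsCrux): given the `N`-uniform forecast-loss envelope
  `h₁ : S_N(t) ≤ C(1+t)^{−α}`, `α > 2` (the statement of the neighbouring stub `stub_forecastLoss`, taken as an explicit
  HYPOTHESIS, never asserted), `N(γ²/T²)∫₀^∞ C_N → κ ↔ N(γ²/T²)∫₀^∞ B_N → κ` for every `κ` (`C_N = powerCov`);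
* `fouriersLaw_iff_kuboForm` (KuboFormFouriersLaw, unconditional after `NessUnique_holds` and `boundaryKubo_proof`):
  `FouriersLaw ↔ ∀ params > 0, ∀ T > 0, ∃ κ > 0, N(γ²/T²)∫₀^∞ C_N → κ`,

we get, with the stub's statement written VERBATIM:

* `varianceLimit_of_forecastLoss_of_fouriersLaw h₁ hF` — envelope + `FouriersLaw` ⇒ the stub;
* `fouriersLaw_of_forecastLoss_of_varianceLimit h₁ h` — envelope + the stub ⇒ `FouriersLaw`;
* `varianceLimit_iff_fouriersLaw_of_forecastLoss h₁` — given the envelope, the stub `↔ FouriersLaw`.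

Reading: modulo the line's engine `stub_forecastLoss`, the stub is EXACTLY the sub-problem conjunct `FouriersLaw`
(`= Literature.MathematicalPhysics.KineticTheory.HeatConduction.FouriersLaw`, Bonetto–Lebowitz–Rey-Bellet 2000, §5.3
eq. (33)), an open problem for every Hamiltonian anharmonic bulk; no `N`-uniform transport estimate for the pinned
anharmonic chain exists in tree or in print. The crux-level analogue is the landed Negative lemma
`LoadBearing.incoherentChannel_iff_fouriersLaw`.

No definition, no `sorry`, axioms standard; every theorem is CONDITIONAL on its displayed hypotheses only.
-/

noncomputable section

open MeasureTheory Set Filter Topology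

namespace Summit.AtomisticToContinuum.FouriersLaw.Theorems.PhononMeanFreePath

open Literature.MathematicalPhysics.KineticTheory.HeatConduction

/-- **Envelope + `FouriersLaw` ⇒ `stub_varianceLimit`.** Given the `N`-uniform forecast-loss envelope `h₁`
(statement of the registered stub `stub_forecastLoss`, a HYPOTHESIS) and the sub-problem conjunct `FouriersLaw`
(open; a HYPOTHESIS), the variance-channel limit holds with the Kubo-form conductivity: `kuboForm_of_fouriersLaw`
gives `κ > 0` with `N(γ²/T²)∫₀^∞ C_N → κ`, and `powerCovLimit_iff_varianceLimit_of_forecastLoss h₁` transports the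
limit to `B_N = C_N − P_N` (`N∫P_N → 0` under the envelope). The conclusion is the stub's statement verbatim.
[folklore] -/
theorem varianceLimit_of_forecastLoss_of_fouriersLaw
    (h₁ : ∀ ω₂ lam β γ : ℝ, 0 < ω₂ → 0 < lam → 0 < β → 0 < γ → ∀ T : ℝ, 0 < T →
      ∃ C α : ℝ, 2 < α ∧ ∀ (N : ℕ) (t : ℝ), 0 ≤ t → fnorm ω₂ lam β γ T N t ≤ C * (1 + t) ^ (-α))
    (hF : _root_.FouriersLaw) :
    ∀ ω₂ lam β γ : ℝ, 0 < ω₂ → 0 < lam → 0 < β → 0 < γ → ∀ T : ℝ, 0 < T →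
      ∃ κ : ℝ, 0 < κ ∧ Tendsto (fun N : ℕ => (N : ℝ) * (γ ^ 2 / T ^ 2) *
          ∫ t in Ioi (0 : ℝ), varianceChannel ω₂ lam β γ T N t) atTop (𝓝 κ) := by
  intro ω₂ lam β γ hω hl hβ hγ T hT
  obtain ⟨κ, hκ, hlim⟩ := kuboForm_of_fouriersLaw hF ω₂ lam β γ hω hl hβ hγ T hT
  exact ⟨κ, hκ, (powerCovLimit_iff_varianceLimit_of_forecastLoss h₁ hω hl hβ hγ hT κ).1 hlim⟩

/-- **Envelope + `stub_varianceLimit` ⇒ `FouriersLaw`.** Conversely, given the envelope `h₁` and the stub's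
statement `h` (verbatim; a HYPOTHESIS), the Kubo-form Fourier law `∃ κ > 0, N(γ²/T²)∫₀^∞ C_N → κ` follows by
`(powerCovLimit_iff_varianceLimit_of_forecastLoss h₁ …).2`, and `fouriersLaw_of_kuboForm` (unconditional glue over
`NessUnique_holds`, `boundaryKubo_proof`, `pinnedChain_exists_isSteadyState`) yields the conjunct. [folklore] -/
theorem fouriersLaw_of_forecastLoss_of_varianceLimit
    (h₁ : ∀ ω₂ lam β γ : ℝ, 0 < ω₂ → 0 < lam → 0 < β → 0 < γ → ∀ T : ℝ, 0 < T →
      ∃ C α : ℝ, 2 < α ∧ ∀ (N : ℕ) (t : ℝ), 0 ≤ t → fnorm ω₂ lam β γ T N t ≤ C * (1 + t) ^ (-α))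
    (h : ∀ ω₂ lam β γ : ℝ, 0 < ω₂ → 0 < lam → 0 < β → 0 < γ → ∀ T : ℝ, 0 < T →
      ∃ κ : ℝ, 0 < κ ∧ Tendsto (fun N : ℕ => (N : ℝ) * (γ ^ 2 / T ^ 2) *
          ∫ t in Ioi (0 : ℝ), varianceChannel ω₂ lam β γ T N t) atTop (𝓝 κ)) :
    _root_.FouriersLaw := by
  refine fouriersLaw_of_kuboForm (fun ω₂ lam β γ hω hl hβ hγ T hT => ?_)
  obtain ⟨κ, hκ, hlim⟩ := h ω₂ lam β γ hω hl hβ hγ T hT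
  exact ⟨κ, hκ, (powerCovLimit_iff_varianceLimit_of_forecastLoss h₁ hω hl hβ hγ hT κ).2 hlim⟩

/-- **CERTIFICATE: given the forecast-loss envelope, `stub_varianceLimit ↔ FouriersLaw`.** Modulo the line's engine
(`stub_forecastLoss`, hypothesis `h₁`), the registered transport-core stub of crux `IncoherentChannel` — written
verbatim on the left — is EQUIVALENT to the sub-problem conjunct `FouriersLaw` for the pinned anharmonic chain
(Bonetto–Lebowitz–Rey-Bellet 2000, §5.3 eq. (33); open). Hence the stub is conjunct-sized by construction and cannot
be discharged short of proving Fourier's law itself. [folklore] -/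
theorem varianceLimit_iff_fouriersLaw_of_forecastLoss : (∀ ω₂ lam β γ : ℝ, 0 < ω₂ → 0 < lam → 0 < β → 0 < γ → ∀ T : ℝ, 0 < T → ∃ C α : ℝ, 2 < α ∧ ∀ (N : ℕ) (t : ℝ), 0 ≤ t → fnorm ω₂ lam β γ T N t ≤ C * (1 + t) ^ (-α)) → ((∀ ω₂ lam β γ : ℝ, 0 < ω₂ → 0 < lam → 0 < β → 0 < γ → ∀ T : ℝ, 0 < T → ∃ κ : ℝ, 0 < κ ∧ Tendsto (fun N : ℕ => (N : ℝ) * (γ ^ 2 / T ^ 2) * ∫ t in Ioi (0 : ℝ), varianceChannel ω₂ lam β γ T N t) atTop (𝓝 κ)) ↔ _root_.FouriersLaw) := by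
  intro h₁
  exact ⟨fouriersLaw_of_forecastLoss_of_varianceLimit h₁, varianceLimit_of_forecastLoss_of_fouriersLaw h₁⟩

/-- **The stub's `κ` is forced.** Given the envelope, at each admissible parameter point the limit `κ` in the stub's
statement, if it exists, equals the Kubo-form limit `lim_N N(γ²/T²)∫₀^∞ C_N` (Hausdorff uniqueness of limits after
`powerCovLimit_iff_varianceLimit_of_forecastLoss`): the variance channel carries no freedom of normalisation beyond
Fourier's law. [folklore] -/
theorem varianceLimit_unique_of_forecastLoss
    (h₁ : ∀ ω₂ lam β γ : ℝ, 0 < ω₂ → 0 < lam → 0 < β → 0 < γ → ∀ T : ℝ, 0 < T →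
      ∃ C α : ℝ, 2 < α ∧ ∀ (N : ℕ) (t : ℝ), 0 ≤ t → fnorm ω₂ lam β γ T N t ≤ C * (1 + t) ^ (-α))
    {ω₂ lam β γ : ℝ} (hω : 0 < ω₂) (hl : 0 < lam) (hβ : 0 < β) (hγ : 0 < γ) {T : ℝ} (hT : 0 < T) {κ κ' : ℝ}
    (hB : Tendsto (fun N : ℕ => (N : ℝ) * (γ ^ 2 / T ^ 2) *
      ∫ t in Ioi (0 : ℝ), varianceChannel ω₂ lam β γ T N t) atTop (𝓝 κ))
    (hC : Tendsto (fun N : ℕ => (N : ℝ) * (γ ^ 2 / T ^ 2) *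
      ∫ t in Ioi (0 : ℝ), powerCov ω₂ lam β γ T N t) atTop (𝓝 κ')) :
    κ = κ' :=
  tendsto_nhds_unique hB ((powerCovLimit_iff_varianceLimit_of_forecastLoss h₁ hω hl hβ hγ hT κ').1 hC)

end Summit.AtomisticToContinuum.FouriersLaw.Theorems.PhononMeanFreePath

end
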